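import Summits.KontsevichZagierPeriods.KontsevichZagierPeriods.Theorems.RootDecompOrderCutAdicStagesP3

/-! # `RootDecompOrderCutAdicStagesP4` — part 4/5 of the mechanical ≤350-line split of `src.lean`
(split by the decomp-kz census seat for landing; mathematics unchanged; part 4 continues part 3). -/

noncomputable section
open Literature.NumberTheory.Transcendental Literature.NumberTheory.Transcendental.KZ
open Summit.KontsevichZagierPeriods.KontsevichZagierPeriods.Theses
open Summit.KontsevichZagierPeriods.RootDecompPureDefect
open Summit.KontsevichZagierPeriods.RootDecompOrderCut
open Polynomial

namespace Summit.KontsevichZagierPeriods.RootDecompAdicStages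

namespace Iface

/-- `𝔛 ⊭ 27508`: the defect `e = (0, X + X²)` admits no `ϖᵏ·e = e²·h` (evaluate at `X = −1`).  So `PiFlatDefect`
is NOT automatic on a one-pair stage, although the pair's own defect `ϖ − g = 2d` satisfies it (`ϖ·d = d²`). -/
theorem modelCross_not_piFlat : ¬ PiFlatDefectI vCross piCross := by
  intro h
  obtain ⟨k, c, hk⟩ := h eCross vCross_eCross
  have h1 := congrArg (fun z : crossCarrier => (z : ℚ[X] × ℚ[X]).2) hk
  simp only [Subring.coe_mul, SubmonoidClass.coe_pow, coe_piCross, coe_eCross, Prod.snd_mul, Prod.pow_snd] at h1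
  -- h1 : X ^ k * (X + X * X) = (X + X * X) * (X + X * X) * c₂
  have hne : (X + X * X : ℚ[X]) ≠ 0 := by
    intro h0
    have := congrArg (Polynomial.eval 1) h0
    rw [Polynomial.eval_add, Polynomial.eval_mul, Polynomial.eval_X, Polynomial.eval_zero] at this
    norm_num at this
  have h2 : X ^ k = (X + X * X) * ((c : ℚ[X] × ℚ[X]).2) := by
    apply mul_left_cancel₀ hne
    linear_combination h1
  have h3 := congrArg (Polynomial.eval (-1)) h2
  rw [Polynomial.eval_pow, Polynomial.eval_X, Polynomial.eval_mul, Polynomial.eval_add, Polynomial.eval_mul,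
    Polynomial.eval_X] at h3
  have h4 : ((-1 : ℚ)) ^ k = 0 := by rw [h3]; ring
  exact pow_ne_zero k (neg_ne_zero.mpr one_ne_zero) h4

/-! ### `𝔑` — the torsion phantom `ℚ[X] ×_ℚ ℚ[ε]/(ε²)`, `ϖ = (X, 0)` -/

/-- carrier of `𝔑`: pairs `(a, d) ∈ ℚ[X] × ℚ[ε]/(ε²)` with `a(0) = d mod ε`. -/
def nilCarrier : Subring (ℚ[X] × DualNumber ℚ) where
  carrier := {z | Polynomial.eval 0 z.1 = TrivSqZeroExt.fst z.2}
  mul_mem' {z w} hz hw := by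
    simp only [Set.mem_setOf_eq] at hz hw ⊢
    rw [Prod.fst_mul, Prod.snd_mul, Polynomial.eval_mul, TrivSqZeroExt.fst_mul, hz, hw]
  one_mem' := by simp
  add_mem' {z w} hz hw := by
    simp only [Set.mem_setOf_eq] at hz hw ⊢
    rw [Prod.fst_add, Prod.snd_add, Polynomial.eval_add, TrivSqZeroExt.fst_add, hz, hw]
  zero_mem' := by simp
  neg_mem' {z} hz := by
    simp only [Set.mem_setOf_eq] at hz ⊢
    rw [Prod.fst_neg, Prod.snd_neg, Polynomial.eval_neg, TrivSqZeroExt.fst_neg, hz]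

/-- value map of `𝔑`: `(a, d) ↦ a(π)`. -/
def vNil : nilCarrier →+* ℝ :=
  (Polynomial.aeval Real.pi).toRingHom.comp ((RingHom.fst ℚ[X] (DualNumber ℚ)).comp nilCarrier.subtype)

/-- Auxiliary step `vNil_apply`. [bookkeeping] -/
theorem vNil_apply (x : nilCarrier) : vNil x = Polynomial.aeval Real.pi x.1.1 := rfl

/-- disc class `ϖ = (X, 0)` of `𝔑`. -/
def piNil : nilCarrier := ⟨(X, 0), by change Polynomial.eval 0 (X : ℚ[X]) = TrivSqZeroExt.fst 0; simp⟩

/-- the phantom `ε = (0, ε)` of `𝔑`. -/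
def epsNil : nilCarrier :=
  ⟨(0, DualNumber.eps), by change Polynomial.eval 0 (0 : ℚ[X]) = TrivSqZeroExt.fst DualNumber.eps; simp⟩

/-- Auxiliary step `vNil_piNil`. [bookkeeping] -/
theorem vNil_piNil : vNil piNil = Real.pi := by rw [vNil_apply]; exact aeval_X Real.pi

/-- Auxiliary step `vNil_epsNil`. [bookkeeping] -/
theorem vNil_epsNil : vNil epsNil = 0 := by rw [vNil_apply]; exact map_zero _

/-- Auxiliary step `epsNil_ne_zero`. [bookkeeping] -/
theorem epsNil_ne_zero : epsNil ≠ 0 := fun h => by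
  have h1 := congrArg (fun z : nilCarrier => TrivSqZeroExt.snd z.1.2) h
  simp [epsNil] at h1

/-- Defects of `𝔑` are `(0, bε)`: pairwise products vanish and `ϖ` kills them (LINDEMANN on the first coordinate). -/
theorem nil_defect_mul {x y : nilCarrier} (hx : vNil x = 0) (hy : vNil y = 0) : x * y = 0 ∧ piNil * x = 0 := by
  obtain ⟨⟨a, d⟩, hmem⟩ := x
  obtain ⟨⟨b, e⟩, hmem'⟩ := y
  rw [vNil_apply] at hx hy
  have ha : a = 0 := aeval_pi_eq_zero_imp hx
  have hb : b = 0 := aeval_pi_eq_zero_imp hy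
  have hd : TrivSqZeroExt.fst d = 0 := by
    have : Polynomial.eval 0 a = TrivSqZeroExt.fst d := hmem
    rw [← this, ha, Polynomial.eval_zero]
  have he : TrivSqZeroExt.fst e = 0 := by
    have : Polynomial.eval 0 b = TrivSqZeroExt.fst e := hmem'
    rw [← this, hb, Polynomial.eval_zero]
  subst ha hb
  constructor
  · apply Subtype.ext
    change ((0 : ℚ[X]), d) * (0, e) = 0
    rw [Prod.ext_iff]
    refine ⟨by simp, ?_⟩
    change d * e = 0
    refine TrivSqZeroExt.ext ?_ ?_
    · rw [TrivSqZeroExt.fst_mul, hd, zero_mul, TrivSqZeroExt.fst_zero]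
    · rw [TrivSqZeroExt.snd_mul, hd, he, zero_smul, MulOpposite.op_zero, zero_smul, add_zero,
        TrivSqZeroExt.snd_zero]
  · apply Subtype.ext
    change ((X : ℚ[X]), (0 : DualNumber ℚ)) * (0, d) = 0
    rw [Prod.ext_iff]
    simp

/-- Auxiliary step `modelNil_piPower`. [bookkeeping] -/
theorem modelNil_piPower : PiPowerDefectI vNil piNil := fun x hx =>
  ⟨1, by rw [pow_one]; exact (nil_defect_mul hx hx).2⟩

/-- Auxiliary step `modelNil_piFlat`. [bookkeeping] -/
theorem modelNil_piFlat : PiFlatDefectI vNil piNil := fun x hx =>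
  ⟨1, 0, by rw [pow_one, (nil_defect_mul hx hx).2, (nil_defect_mul hx hx).1, zero_mul]⟩

/-- Auxiliary step `modelNil_locTriv`. [bookkeeping] -/
theorem modelNil_locTriv : LocTrivI vNil :=
  locTriv_of_piPower (ϖ := piNil) (by rw [vNil_piNil]; exact Real.pi_ne_zero) modelNil_piPower

/-- Auxiliary step `modelNil_piConnected`. [bookkeeping] -/
theorem modelNil_piConnected : PiConnectedI vNil piNil := fun f _ hf =>
  ⟨1, by rw [pow_one]; exact (nil_defect_mul hf hf).2⟩

/-- `𝔑 ⊨ AdicSeparated`: `x = i·x = i·(i·x) = i²·x = 0`. -/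
theorem modelNil_adicSeparated : AdicSeparatedI vNil := fun x i hi hix =>
  calc x = i * (i * x) := by rw [hix, hix]
    _ = 0 := by rw [← mul_assoc, (nil_defect_mul hi hi).1, zero_mul]

/-- `𝔑 ⊭ AdicDefect`: every defect kills `ε`, none fixes it. -/
theorem modelNil_not_adicDefect : ¬ AdicDefectI vNil := by
  intro h
  obtain ⟨i, hi, hix⟩ := h epsNil vNil_epsNil
  rw [(nil_defect_mul hi vNil_epsNil).1] at hix
  exact epsNil_ne_zero hix.symm

/-- Auxiliary step `modelNil_not_cancellation`. [bookkeeping] -/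
theorem modelNil_not_cancellation : ¬ CancellationI vNil := fun h =>
  epsNil_ne_zero (h piNil epsNil (by rw [vNil_piNil]; exact Real.pi_ne_zero)
    (nil_defect_mul vNil_epsNil vNil_epsNil).2)

/-- Auxiliary step `modelNil_not_s`. [bookkeeping] -/
theorem modelNil_not_s : ¬ SI vNil := fun h => epsNil_ne_zero (h epsNil vNil_epsNil)

/-! ### `𝔜` — the hinge `ℝ[X] ×_{X = 1 ↔ Y = 0} ℝ[Y]`, `v = f(0)` -/

/-- carrier of `𝔜`: pairs `(f, g)` with `f(1) = g(0)`. -/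
def hingeCarrier : Subring (ℝ[X] × ℝ[X]) :=
  RingHom.eqLocus ((Polynomial.evalRingHom 1).comp (RingHom.fst ℝ[X] ℝ[X]))
    ((Polynomial.evalRingHom 0).comp (RingHom.snd ℝ[X] ℝ[X]))

/-- Membership in `hingeCarrier`, unfolded. [bookkeeping] -/
theorem mem_hingeCarrier {z : ℝ[X] × ℝ[X]} : z ∈ hingeCarrier ↔ z.1.eval 1 = z.2.eval 0 := Iff.rfl

/-- value map of `𝔜`: `(f, g) ↦ f(0)`. -/
def vHinge : hingeCarrier →+* ℝ := (Polynomial.evalRingHom 0).comp ((RingHom.fst ℝ[X] ℝ[X]).comp hingeCarrier.subtype)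

/-- Auxiliary step `vHinge_apply`. [bookkeeping] -/
theorem vHinge_apply (z : hingeCarrier) : vHinge z = (z : ℝ[X] × ℝ[X]).1.eval 0 := rfl

/-- Auxiliary step `poly_idem`. [bookkeeping] -/
theorem poly_idem {p : ℝ[X]} (h : IsIdempotentElem p) : p = 0 ∨ p = 1 := by
  have h1 : p * (p - 1) = 0 := by rw [mul_sub, mul_one, h.eq, sub_self]
  rcases mul_eq_zero.mp h1 with h2 | h2
  · exact Or.inl h2
  · exact Or.inr (sub_eq_zero.mp h2)

/-- `𝔜 ⊨ Connected` (two lines glued at one point). -/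
theorem modelHinge_connected : ConnectedI vHinge := by
  intro e he hve
  have hmem : (e : ℝ[X] × ℝ[X]).1.eval 1 = (e : ℝ[X] × ℝ[X]).2.eval 0 := mem_hingeCarrier.mp e.2
  have hc := congrArg (fun z : hingeCarrier => (z : ℝ[X] × ℝ[X])) he.eq
  simp only [Subring.coe_mul, Prod.ext_iff, Prod.fst_mul, Prod.snd_mul] at hc
  rw [vHinge_apply] at hve
  have h1 : (e : ℝ[X] × ℝ[X]).1 = 0 := by
    rcases poly_idem (p := (e : ℝ[X] × ℝ[X]).1) hc.1 with h | h
    · exact h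
    · exfalso; rw [h, Polynomial.eval_one] at hve; exact one_ne_zero hve
  have h2 : (e : ℝ[X] × ℝ[X]).2 = 0 := by
    rcases poly_idem (p := (e : ℝ[X] × ℝ[X]).2) hc.2 with h | h
    · exact h
    · exfalso; rw [h1, h, Polynomial.eval_zero, Polynomial.eval_one] at hmem; exact zero_ne_one hmem
  exact Subtype.ext (Prod.ext h1 h2)

/-- `𝔜 ⊭ AdicSeparated`: `i = (X, 1)` has value `0` and fixes `x = (0, Y) ≠ 0`. -/
theorem modelHinge_not_adicSeparated : ¬ AdicSeparatedI vHinge := by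
  intro h
  let i : hingeCarrier := ⟨(X, 1), by rw [mem_hingeCarrier]; simp⟩
  let x : hingeCarrier := ⟨(0, X), by rw [mem_hingeCarrier]; simp⟩
  have h1 := h x i (by rw [vHinge_apply]; exact Polynomial.eval_X) (Subtype.ext (by simp [i, x]))
  have h2 := congrArg (fun z : hingeCarrier => (z : ℝ[X] × ℝ[X]).2) h1
  simp only [x, Subring.coe_zero, Prod.snd_zero] at h2
  exact X_ne_zero h2

/-- Auxiliary step `modelHinge_not_s`. [bookkeeping] -/
theorem modelHinge_not_s : ¬ SI vHinge := fun h =>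
  modelHinge_not_adicSeparated (adicSeparated_of_s h)

/-! ### `𝔓 = ℚ[x^{ℚ≥0}]` (Puiseux polynomials), `v =` constant term: why the left half must be `AdicDefect` -/

/-- Puiseux polynomials `ℚ[x^{ℚ≥0}]` (a non-Noetherian domain). -/
abbrev Puiseux := AddMonoidAlgebra ℚ NNRat

/-- indicator character of the monoid `ℚ≥0`: `x⁰ ↦ 1`, `x^q ↦ 0` (`q > 0`). -/
def indHom : Multiplicative NNRat →* ℝ where
  toFun q := if Multiplicative.toAdd q = 0 then 1 else 0
  map_one' := by simp
  map_mul' a b := by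
    by_cases ha : Multiplicative.toAdd a = 0 <;> by_cases hb : Multiplicative.toAdd b = 0 <;>
      simp [toAdd_mul, ha, hb]

/-- Auxiliary step `indHom_apply`. [bookkeeping] -/
theorem indHom_apply (q : NNRat) : indHom (Multiplicative.ofAdd q) = if q = 0 then 1 else 0 := rfl

/-- the character `v =` constant term of `𝔓`. -/
def vPuis : Puiseux →+* ℝ := AddMonoidAlgebra.liftNCRingHom (Rat.castHom ℝ) indHom fun _ _ => Commute.all _ _

/-- Auxiliary step `vPuis_single`. [bookkeeping] -/
theorem vPuis_single (q : NNRat) (c : ℚ) :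
    vPuis (AddMonoidAlgebra.single q c) = (c : ℝ) * (if q = 0 then 1 else 0) := by
  change AddMonoidAlgebra.liftNCRingHom (Rat.castHom ℝ) indHom _ (AddMonoidAlgebra.single q c) = _
  rw [AddMonoidAlgebra.liftNCRingHom_single, indHom_apply, eq_ratCast]

/-- Auxiliary step `vPuis_single_of_ne`. [bookkeeping] -/
theorem vPuis_single_of_ne {q : NNRat} (hq : q ≠ 0) (c : ℚ) : vPuis (AddMonoidAlgebra.single q c) = 0 := by
  rw [vPuis_single, if_neg hq, mul_zero]

/-- Auxiliary step `vPuis_single_zero`. [bookkeeping] -/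
theorem vPuis_single_zero (c : ℚ) : vPuis (AddMonoidAlgebra.single 0 c) = c := by
  rw [vPuis_single, if_pos rfl, mul_one]

/-- monomials of positive exponent lie in `(ker v)²`: `x^q = x^{q/2}·x^{q/2}`. -/
theorem single_mem_ker_sq {q : NNRat} (hq : q ≠ 0) (c : ℚ) :
    AddMonoidAlgebra.single q c ∈ RingHom.ker vPuis * RingHom.ker vPuis := by
  have hq2 : q / 2 ≠ 0 := div_ne_zero hq two_ne_zero
  have e : AddMonoidAlgebra.single q c =
      AddMonoidAlgebra.single (q / 2) c * AddMonoidAlgebra.single (q / 2) (1 : ℚ) := by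
    rw [AddMonoidAlgebra.single_mul_single, mul_one, ← mul_two, div_mul_cancel₀ q two_ne_zero]
  rw [e]
  exact Ideal.mul_mem_mul ((RingHom.mem_ker).mpr (vPuis_single_of_ne hq2 c))
    ((RingHom.mem_ker).mpr (vPuis_single_of_ne hq2 1))

/-- the positive-exponent part of `x` lies in `(ker v)²`. -/
theorem tail_mem_ker_sq (x : Puiseux) :
    AddMonoidAlgebra.ofCoeff (x.coeff.erase 0) ∈ RingHom.ker vPuis * RingHom.ker vPuis := by
  rw [← AddMonoidAlgebra.sum_coeff_single (AddMonoidAlgebra.ofCoeff (x.coeff.erase 0)),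
    AddMonoidAlgebra.coeff_ofCoeff, Finsupp.sum]
  refine Submodule.sum_mem _ fun q hq => ?_
  rw [Finsupp.support_erase, Finset.mem_erase] at hq
  exact single_mem_ker_sq hq.1 _

/-- `x = (constant term) + (positive-exponent part)`. -/
theorem puis_decomp (x : Puiseux) :
    x = AddMonoidAlgebra.single 0 (x.coeff 0) + AddMonoidAlgebra.ofCoeff (x.coeff.erase 0) := by
  calc x = AddMonoidAlgebra.ofCoeff x.coeff := rfl
    _ = AddMonoidAlgebra.ofCoeff (Finsupp.single 0 (x.coeff 0) + x.coeff.erase 0) := by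
        rw [Finsupp.single_add_erase]
    _ = _ := rfl

/-- Auxiliary step `vPuis_apply`. [bookkeeping] -/
theorem vPuis_apply (x : Puiseux) : vPuis x = (x.coeff 0 : ℚ) := by
  have h2 : vPuis (AddMonoidAlgebra.ofCoeff (x.coeff.erase 0)) = 0 :=
    (RingHom.mem_ker).mp (Ideal.mul_le_right (tail_mem_ker_sq x))
  conv_lhs => rw [puis_decomp x]
  rw [map_add, h2, add_zero, vPuis_single_zero]

/-- `𝔓 ⊨ KernelIdempotent`: `𝔪 = (x^q : q > 0) = 𝔪²`. -/
theorem modelPuis_kernelIdempotent : KernelIdempotentI vPuis := by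
  intro x hx
  rw [vPuis_apply] at hx
  have hx0 : x.coeff 0 = 0 := by exact_mod_cast hx
  have e : x = AddMonoidAlgebra.ofCoeff (x.coeff.erase 0) := by
    conv_lhs => rw [puis_decomp x]
    rw [hx0, AddMonoidAlgebra.single_zero, zero_add]
  rw [e]
  exact tail_mem_ker_sq x

/-- Auxiliary step `modelPuis_cancellation`. [bookkeeping] -/
theorem modelPuis_cancellation : CancellationI vPuis := by
  intro g x hg hgx
  rcases mul_eq_zero.mp hgx with h | h
  · exact absurd (by rw [h, map_zero]) hg
  · exact h

/-- Auxiliary step `modelPuis_adicSeparated`. [bookkeeping] -/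
theorem modelPuis_adicSeparated : AdicSeparatedI vPuis := adicSeparated_of_cancellation modelPuis_cancellation

/-- the monomial `x = x¹` of `𝔓`. -/
def xPuis : Puiseux := AddMonoidAlgebra.single 1 1

/-- Auxiliary step `vPuis_xPuis`. [bookkeeping] -/
theorem vPuis_xPuis : vPuis xPuis = 0 := vPuis_single_of_ne one_ne_zero 1

/-- Auxiliary step `xPuis_ne_zero`. [bookkeeping] -/
theorem xPuis_ne_zero : xPuis ≠ 0 := AddMonoidAlgebra.single_ne_zero.mpr one_ne_zero

/-- `𝔓 ⊭ AdicDefect` (a domain: `i·x = x ⟹ i = 1`). -/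
theorem modelPuis_not_adicDefect : ¬ AdicDefectI vPuis := by
  intro h
  obtain ⟨i, hi, hix⟩ := h xPuis vPuis_xPuis
  have h1 : (i - 1) * xPuis = 0 := by rw [sub_mul, one_mul, hix, sub_self]
  rcases mul_eq_zero.mp h1 with h2 | h2
  · rw [sub_eq_zero] at h2
    rw [h2, map_one] at hi
    exact one_ne_zero hi
  · exact xPuis_ne_zero h2

end Iface
end Summit.KontsevichZagierPeriods.RootDecompAdicStages
end
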